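import Summits.RiemannHypothesis.RiemannHypothesis.Theorems.PfPersistenceGalerkinDownCone
import Summits.RiemannHypothesis.RiemannHypothesis.Theorems.PfPersistenceInWindowMirror
import Summits.RiemannHypothesis.RiemannHypothesis.Theorems.PfPersistenceParityMassLaw
import HarnessLib

/-!
# PF persistence — the AUTOCORRELATION (LEVEL-DROP) SPLITTING LAW at every window (pub-rhpf, cand-6 gen 8)

**HONEST FRAMING. This is a long-odds MECHANISM / RIGIDITY campaign; no RH claims.** Everything below is RH-free,
binder-free linear algebra plus one windowed-autocorrelation inequality about the cell's observatory records
(`Datum` = even blocks `evenBlock w win` of truncated Weil forms); nothing here bears on the truth of RH. Every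
statement is labelled PROVED (kernel) or DATA (numbers measured elsewhere, quoted in remarks only).

## What is proved ("below the reference is nodal")

Row C6-PARITY-SPLIT of the gap ledger (`PfPersistenceParitySplitLaw`, `…ParitySplitGen`) forces NODALITY of the
bottom vectors of a dialled block only at the MIRROR windows `a = log p` (where the one-prime pattern is the sign
diagonal). This file removes the restriction to mirror windows: the cone replacing the parity classes is the
ONE-SIGNED cone itself, on which every one-prime pattern form is a nonnegative windowed autocorrelation (tree,
`primePattern_form_nonneg_of_oneSigned`).

* §1 (PROVED, matrix level) LEVEL DROP FORCES A NEGATIVE INCREMENT: for window matrices `Q, Q'` and a bottom vector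
  `u` of `Q'`, `uᵀQ'u − uᵀQu ≤ (ε₁(Q') − ε₁(Q))‖u‖²`; so `ε₁(Q') < ε₁(Q)` makes `uᵀ(Q' − Q)u < 0` on every bottom
  vector; and the VARIATIONAL TRIGGER `vᵀQ'v < ε₁(Q)‖v‖²` for one test vector certifies the drop.
* §2 (PROVED, even sector, the whole DOWN CONE) for tables `w' ≤ w` on the window's primes (dials `K ≤ 1`, deletions,
  sign flips `K < 0`, dressings `f ≤ 1`): `uᵀ(Q_{w'} − Q_w)u = 2 Σ_q (w q − w' q)·autocorr_u(log q) ≥ 0` on one-signed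
  `u`; hence a LEVEL DROP `ε₁(Q_{w'}; win) < ε₁(Q_w; win)` forces EVERY bottom vector of `Q_{w'}` to change sign:
  `datumOf w' ∉ oneSignedAt win`. Contrapositively a down-cone datum that is nodeless-even at `win` DOMINATES the
  reference there (`ε₁(Q_w) ≤ ε₁(Q_{w'})`), and a down-cone datum nodeless at every window of an all-windows-positive
  reference is all-windows positive (no down-cone nodeless twin among the negatives of a positive reference).
  One-dial thresholds: a test vector `v` of the reference with level `vᵀQ_w v ≤ ℓ‖v‖²` ANTI-CORRELATED at lag
  `log p`, `autocorr_v(log p) ≤ −σ‖v‖²`, certifies the drop for every `K ≤ 1` with `2(1−K)·w(p)·σ > ℓ − ε₁(Q_w)`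
  and window NEGATIVITY for `2(1−K)·w(p)·σ > ℓ`.
* §3 (PROVED, the served `φ`-FLOORED reader) a `φ`-floor one-signed profile has `autocorr_u(y) ≥ −2φ(2N+1)‖u‖²` at
  every lag `0 ≤ y ≤ L` (pointwise `θ(x)θ(x+y) ≥ −2φ·max|θ|²`, and `max|θ|²·L ≤ (2N+1)‖u‖²`, tree `profileMax_sq_le`);
  hence a drop by more than `4φ(2N+1)·Σ_q (w q − w' q)` forces `datumOf w' ∉ floorNodelessAt φ win`, with the
  one-dial threshold `2(1−K)·w(p)·(σ − 2φ(2N+1)) > ℓ − ε₁(Q_w)`.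

Remarks (no restatement of landed theorems). (i) At `a = log p` §2 specialises to the parity-splitting law of
`PfPersistenceParitySplitGen` (cone = a parity class there, the one-signed cone here; on both the increment is
copositive). (ii) The UP side `K ≥ 1` is the tree's `bottomRayleigh_dial_le_rayleigh` (F5LayerSigns): up moves only
lower positively-correlated vectors and force nothing on signs — the Perron side, where the certified nodeless twins of
record live (DATA, e.g. F5-T₂*, `K = 1 + 3.8·10⁻²⁵⁹`). (iii) DATA enter only through `ℓ, σ, ε₁(Q_w)` of a test vector.
-/

set_option linter.dupNamespace false  -- the mandated namespace repeats `RiemannHypothesis`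

noncomputable section

open Real Set Matrix Finset

namespace Summit.RiemannHypothesis.RiemannHypothesis.Theorems.PfPersistence

/-! ## §1 Matrix level: level drop forces a negative increment on every bottom vector -/

/-- PROVED: for a bottom vector `u` of `Q'`, `uᵀQ'u − uᵀQu ≤ (ε₁(Q') − ε₁(Q)) · uᵀu`. [folklore] -/
theorem form_sub_le_of_isBottomVector {n : ℕ} (Q Q' : Matrix (Fin n) (Fin n) ℝ) {u : Fin n → ℝ}
    (hu : IsBottomVector Q' u) :
    u ⬝ᵥ (Q' *ᵥ u) - u ⬝ᵥ (Q *ᵥ u) ≤ (bottomRayleigh Q' - bottomRayleigh Q) * (u ⬝ᵥ u) := by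
  have h1 : u ⬝ᵥ (Q' *ᵥ u) = bottomRayleigh Q' * (u ⬝ᵥ u) := by rw [hu.2, dotProduct_smul, smul_eq_mul]
  have h2 := bottomRayleigh_mul_le_form Q u
  rw [h1]
  linarith

/-- **PROVED — LEVEL DROP FORCES A NEGATIVE INCREMENT:** if `ε₁(Q') < ε₁(Q)` then `uᵀ(Q' − Q)u < 0` for every bottom
vector `u` of `Q'`. [folklore] -/
theorem form_sub_neg_of_levelDrop {n : ℕ} (Q Q' : Matrix (Fin n) (Fin n) ℝ) {u : Fin n → ℝ}
    (hu : IsBottomVector Q' u) (hdrop : bottomRayleigh Q' < bottomRayleigh Q) :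
    u ⬝ᵥ (Q' *ᵥ u) - u ⬝ᵥ (Q *ᵥ u) < 0 := by
  have huu : 0 < u ⬝ᵥ u :=
    lt_of_le_of_ne (dotProduct_self_nonneg_real u) fun h => hu.1 (dotProduct_self_eq_zero.1 h.symm)
  exact (form_sub_le_of_isBottomVector Q Q' hu).trans_lt (mul_neg_of_neg_of_pos (sub_neg.2 hdrop) huu)

/-- **PROVED — THE VARIATIONAL TRIGGER:** one test vector `v ≠ 0` with `vᵀQ'v < ε₁(Q) · vᵀv` certifies the level drop
`ε₁(Q') < ε₁(Q)`. [folklore] -/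
theorem levelDrop_of_testVector {n : ℕ} (Q Q' : Matrix (Fin n) (Fin n) ℝ) {v : Fin n → ℝ} (hv : v ≠ 0)
    (hlt : v ⬝ᵥ (Q' *ᵥ v) < bottomRayleigh Q * (v ⬝ᵥ v)) : bottomRayleigh Q' < bottomRayleigh Q := by
  have hvv : 0 < v ⬝ᵥ v :=
    lt_of_le_of_ne (dotProduct_self_nonneg_real v) fun h => hv (dotProduct_self_eq_zero.1 h.symm)
  have h := bottomRayleigh_le_rayleigh Q' hv
  rw [le_div_iff₀ hvv] at h
  exact lt_of_mul_lt_mul_right (h.trans_lt hlt) hvv.le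

/-! ## §2 Even sector: below the reference, every bottom vector of a down-cone table is nodal -/

/-- PROVED (the form of any table on a test vector, relative to a reference table):
`vᵀQ_{w'}v = vᵀQ_w v + 2 Σ_{q ∈ primeRange 2a} (w q − w' q) · autocorr_v(log q)` (the prime block is SUBTRACTED in
the Weil form, so lowering weights raises the form on positively-correlated vectors). [folklore] -/
theorem form_eq_form_add_sum_autocorr {win : Window} (w w' : Weights) (v : Fin (win.N + 1) → ℝ) :
    v ⬝ᵥ (evenBlock w' win *ᵥ v) = v ⬝ᵥ (evenBlock w win *ᵥ v)
      + 2 * ∑ q ∈ primeRange (2 * win.a), (w q - w' q) * autocorr (2 * win.a) v (Real.log q) := by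
  have h := evenBlock_form_sub (win := win) w w' v
  rw [primesBlock_form_eq win.ha, primesBlock_form_eq win.ha] at h
  have e : ∑ q ∈ primeRange (2 * win.a), (w q - w' q) * autocorr (2 * win.a) v (Real.log q)
      = ∑ q ∈ primeRange (2 * win.a), w q * autocorr (2 * win.a) v (Real.log q)
        - ∑ q ∈ primeRange (2 * win.a), w' q * autocorr (2 * win.a) v (Real.log q) := by
    rw [← Finset.sum_sub_distrib]
    exact Finset.sum_congr rfl fun q _ => by ring
  rw [e]
  linarith

/-- **PROVED — BELOW THE REFERENCE IS NODAL (down cone, raw reader):** if `w' ≤ w` on the window's primes and the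
bottom level DROPS, `ε₁(Q_{w'}; win) < ε₁(Q_w; win)`, then every bottom vector of `Q_{w'}` changes sign on the window:
on a one-signed `u` the increment `2Σ(w − w')(q)·autocorr_u(log q)` is `≥ 0` (`galerkin_downCone`), but a level drop
makes it `< 0` on bottom vectors (§1). No RH input, every window. [folklore] -/
theorem not_oneSigned_of_downCone_levelDrop {win : Window} {w w' : Weights}
    (hle : ∀ q ∈ primeRange (2 * win.a), w' q ≤ w q)
    (hdrop : bottomRayleigh (evenBlock w' win) < bottomRayleigh (evenBlock w win))
    {u : Fin (win.N + 1) → ℝ} (hu : IsBottomVector (evenBlock w' win) u) : ¬ OneSigned (2 * win.a) u := by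
  intro hone
  have h1 := form_sub_neg_of_levelDrop (evenBlock w win) (evenBlock w' win) hu hdrop
  have h2 := galerkin_downCone win.ha hle hone
  linarith

/-- **PROVED (datum level):** a down-cone table whose bottom level drops at `win` is NOT in `oneSignedAt win`. [folklore] -/
theorem not_mem_oneSignedAt_of_downCone_levelDrop {win : Window} {w w' : Weights}
    (hle : ∀ q ∈ primeRange (2 * win.a), w' q ≤ w q)
    (hdrop : bottomRayleigh (evenBlock w' win) < bottomRayleigh (evenBlock w win)) :
    datumOf w' ∉ oneSignedAt win := by
  rintro ⟨u, hu, hone⟩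
  exact not_oneSigned_of_downCone_levelDrop hle hdrop hu hone

/-- **PROVED — ENERGY DOMINATION (contrapositive):** a down-cone table that is nodeless-even at `win` has bottom level
AT LEAST the reference's there: `ε₁(Q_w; win) ≤ ε₁(Q_{w'}; win)`. [folklore] -/
theorem bottomRayleigh_le_of_downCone_mem_oneSignedAt {win : Window} {w w' : Weights}
    (hle : ∀ q ∈ primeRange (2 * win.a), w' q ≤ w q) (hmem : datumOf w' ∈ oneSignedAt win) :
    bottomRayleigh (evenBlock w win) ≤ bottomRayleigh (evenBlock w' win) :=
  not_lt.1 fun hdrop => not_mem_oneSignedAt_of_downCone_levelDrop hle hdrop hmem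

/-- **PROVED — NO DOWN-CONE NODELESS TWIN BELOW A POSITIVE REFERENCE:** a table `w' ≤ w` (at every prime power) whose
datum is nodeless-even at EVERY window is all-windows positive as soon as the reference is (for `ζ` that premiss,
`AllWindowsPositive zetaDatum`, is RH-strength: CONDITIONAL as a soundness statement; the unconditional content is the
window-wise domination above). [folklore] -/
theorem allWindowsPositive_of_downCone_forall_mem_oneSignedAt {w w' : Weights} (hle : ∀ q, w' q ≤ w q)
    (hmem : ∀ win, datumOf w' ∈ oneSignedAt win) (hpos : AllWindowsPositive (datumOf w)) :
    AllWindowsPositive (datumOf w') := by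
  intro win v
  have h1 := bottomRayleigh_le_of_downCone_mem_oneSignedAt (win := win) (fun q _ => hle q) (hmem win)
  have h2 : 0 ≤ bottomRayleigh (evenBlock w win) :=
    le_bottomRayleigh_of_forall _ fun u _ => div_nonneg (hpos win u) (dotProduct_self_nonneg_real u)
  exact (mul_nonneg (h2.trans h1) (dotProduct_self_nonneg_real v)).trans (bottomRayleigh_mul_le_form _ v)

/-- **PROVED — THE TRIGGER AT TABLE LEVEL:** one test vector `v ≠ 0` with
`vᵀQ_w v + 2Σ_q (w q − w' q)·autocorr_v(log q) < ε₁(Q_w)·vᵀv` certifies the level drop of `Q_{w'}` below `Q_w`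
(any two tables; for a down move the sum must be NEGATIVE: an anti-correlated test vector). [folklore] -/
theorem levelDrop_of_testVector_autocorr {win : Window} (w w' : Weights) {v : Fin (win.N + 1) → ℝ} (hv : v ≠ 0)
    (hlt : v ⬝ᵥ (evenBlock w win *ᵥ v)
        + 2 * ∑ q ∈ primeRange (2 * win.a), (w q - w' q) * autocorr (2 * win.a) v (Real.log q)
      < bottomRayleigh (evenBlock w win) * (v ⬝ᵥ v)) :
    bottomRayleigh (evenBlock w' win) < bottomRayleigh (evenBlock w win) :=
  levelDrop_of_testVector _ _ hv (by rw [form_eq_form_add_sum_autocorr w w' v]; exact hlt)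

/-- PROVED: a multiplicative dressing `f · w_ζ` with `f ≤ 1` (Rademacher signs, deletions, dials `K ≤ 1`) whose bottom
level drops below `ζ`'s at `win` is rejected by the raw nodeless-even reader at `win`. [folklore] -/
theorem dressing_not_mem_oneSignedAt_of_levelDrop {win : Window} {f : ℕ → ℝ} (hf : ∀ q, f q ≤ 1)
    (hdrop : bottomRayleigh (evenBlock (fun q => f q * zetaWeights q) win) < bottomRayleigh (evenBlock zetaWeights win)) :
    datumOf (fun q => f q * zetaWeights q) ∉ oneSignedAt win :=
  not_mem_oneSignedAt_of_downCone_levelDrop (fun q _ => by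
    have := mul_le_mul_of_nonneg_right (hf q) (zetaWeights_nonneg q)
    simpa using this) hdrop

/-! ### One dial `K ≤ 1` -/

/-- PROVED: a dial `K ≤ 1` at a prime power of nonnegative weight is down-cone. [folklore] -/
theorem dial_le_self_of_le_one {p : ℕ} {K : ℝ} (hK : K ≤ 1) {w : Weights} (hw : 0 ≤ w p) (q : ℕ) :
    dial p K w q ≤ w q := by
  unfold dial
  split_ifs with h
  · subst h
    exact mul_le_of_le_one_left hw hK
  · exact le_rfl

/-- **PROVED — A DOWN DIAL BELOW THE REFERENCE IS NODAL:** `K ≤ 1`, `0 ≤ w p`, `ε₁(evenBlock (dial p K w) win) <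
ε₁(evenBlock w win)` ⇒ `datumOf (dial p K w) ∉ oneSignedAt win` (vacuous at windows not reaching `p`). [folklore] -/
theorem dial_not_mem_oneSignedAt_of_levelDrop {win : Window} {p : ℕ} {K : ℝ} (hK : K ≤ 1) {w : Weights}
    (hw : 0 ≤ w p) (hdrop : bottomRayleigh (evenBlock (dial p K w) win) < bottomRayleigh (evenBlock w win)) :
    datumOf (dial p K w) ∉ oneSignedAt win :=
  not_mem_oneSignedAt_of_downCone_levelDrop (fun q _ => dial_le_self_of_le_one hK hw q) hdrop

/-- PROVED (`ζ` handle): a down dial `K ≤ 1` of `ζ` below `ζ`'s even bottom level at `win` is not in `oneSignedAt win`. [folklore] -/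
theorem zeta_dial_not_mem_oneSignedAt_of_levelDrop {win : Window} (p : ℕ) {K : ℝ} (hK : K ≤ 1)
    (hdrop : bottomRayleigh (evenBlock (dial p K zetaWeights) win) < bottomRayleigh (evenBlock zetaWeights win)) :
    datumOf (dial p K zetaWeights) ∉ oneSignedAt win :=
  dial_not_mem_oneSignedAt_of_levelDrop hK (zetaWeights_nonneg p) hdrop

/-- **PROVED — ONE-DIAL TRIGGER:** at a window reaching `p`, a test vector `v ≠ 0` with
`vᵀQ_w v + 2(1−K)·w(p)·autocorr_v(log p) < ε₁(Q_w)·vᵀv` certifies the level drop of the `p`-dial (any `K`). [folklore] -/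
theorem dial_levelDrop_of_testVector {win : Window} {p : ℕ} (hp : p ∈ primeRange (2 * win.a)) (K : ℝ) (w : Weights)
    {v : Fin (win.N + 1) → ℝ} (hv : v ≠ 0)
    (hlt : v ⬝ᵥ (evenBlock w win *ᵥ v) + 2 * (1 - K) * w p * autocorr (2 * win.a) v (Real.log p)
      < bottomRayleigh (evenBlock w win) * (v ⬝ᵥ v)) :
    bottomRayleigh (evenBlock (dial p K w) win) < bottomRayleigh (evenBlock w win) := by
  apply levelDrop_of_testVector _ _ hv
  rw [form_evenBlock_dial hp K w v, primePattern_form_eq_autocorr win.ha]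
  linarith

/-- **PROVED — THE AUTOCORRELATION SPLITTING THRESHOLD (rejection):** at a window reaching `p`, if a test vector
`v ≠ 0` of the reference has level `vᵀQ_w v ≤ ℓ‖v‖²` and is ANTI-CORRELATED at lag `log p`,
`autocorr_v(log p) ≤ −σ‖v‖²`, then every down dial `K ≤ 1` (`0 ≤ w p`) with `2(1−K)·w(p)·σ > ℓ − ε₁(Q_w)` drops the
bottom level — hence is even-NODAL at `win` (`dial_not_mem_oneSignedAt_of_levelDrop`). [folklore] -/
theorem dial_levelDrop_of_threshold {win : Window} {p : ℕ} (hp : p ∈ primeRange (2 * win.a)) {K : ℝ} (hK : K ≤ 1)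
    {w : Weights} (hw : 0 ≤ w p) {v : Fin (win.N + 1) → ℝ} (hv : v ≠ 0) {ℓ σ : ℝ}
    (hℓ : v ⬝ᵥ (evenBlock w win *ᵥ v) ≤ ℓ * (v ⬝ᵥ v))
    (hσ : autocorr (2 * win.a) v (Real.log p) ≤ -σ * (v ⬝ᵥ v))
    (ht : ℓ - bottomRayleigh (evenBlock w win) < 2 * (1 - K) * w p * σ) :
    bottomRayleigh (evenBlock (dial p K w) win) < bottomRayleigh (evenBlock w win) := by
  have hvv : 0 < v ⬝ᵥ v :=
    lt_of_le_of_ne (dotProduct_self_nonneg_real v) fun h => hv (dotProduct_self_eq_zero.1 h.symm)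
  apply dial_levelDrop_of_testVector hp K w hv
  have hc : 0 ≤ 2 * (1 - K) * w p := mul_nonneg (mul_nonneg zero_le_two (sub_nonneg.2 hK)) hw
  have h1 := mul_le_mul_of_nonneg_left hσ hc
  have h2 := mul_lt_mul_of_pos_right ht hvv
  linarith

/-- **PROVED — THE NEGATIVITY THRESHOLD:** under the same data, `2(1−K)·w(p)·σ > ℓ` makes the dialled block
window-NEGATIVE at `win` (`ε₁ < 0`; the larger of the two thresholds). [folklore] -/
theorem dial_bottomRayleigh_neg_of_threshold {win : Window} {p : ℕ} (hp : p ∈ primeRange (2 * win.a)) {K : ℝ}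
    (hK : K ≤ 1) {w : Weights} (hw : 0 ≤ w p) {v : Fin (win.N + 1) → ℝ} (hv : v ≠ 0) {ℓ σ : ℝ}
    (hℓ : v ⬝ᵥ (evenBlock w win *ᵥ v) ≤ ℓ * (v ⬝ᵥ v))
    (hσ : autocorr (2 * win.a) v (Real.log p) ≤ -σ * (v ⬝ᵥ v)) (ht : ℓ < 2 * (1 - K) * w p * σ) :
    bottomRayleigh (evenBlock (dial p K w) win) < 0 := by
  have hvv : 0 < v ⬝ᵥ v :=
    lt_of_le_of_ne (dotProduct_self_nonneg_real v) fun h => hv (dotProduct_self_eq_zero.1 h.symm)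
  have h := bottomRayleigh_mul_le_form (evenBlock (dial p K w) win) v
  rw [form_evenBlock_dial hp K w v, primePattern_form_eq_autocorr win.ha] at h
  have hc : 0 ≤ 2 * (1 - K) * w p := mul_nonneg (mul_nonneg zero_le_two (sub_nonneg.2 hK)) hw
  have h1 := mul_le_mul_of_nonneg_left hσ hc
  have h2 := mul_lt_mul_of_pos_right ht hvv
  have h' : bottomRayleigh (evenBlock (dial p K w) win) * (v ⬝ᵥ v) < 0 := by linarith
  exact lt_of_mul_lt_mul_right (h'.trans_eq (zero_mul (v ⬝ᵥ v)).symm) hvv.le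

/-- **PROVED — REJECTED AND NEGATIVE AT THE SAME WINDOW:** past the negativity threshold the down dial is window-negative
at `win` AND outside `oneSignedAt win`, provided `0 ≤ ε₁(Q_w; win)` (the regime of every served `ζ` record — DATA). [folklore] -/
theorem dial_neg_and_not_mem_oneSignedAt {win : Window} {p : ℕ} (hp : p ∈ primeRange (2 * win.a)) {K : ℝ}
    (hK : K ≤ 1) {w : Weights} (hw : 0 ≤ w p) (href : 0 ≤ bottomRayleigh (evenBlock w win))
    {v : Fin (win.N + 1) → ℝ} (hv : v ≠ 0) {ℓ σ : ℝ}
    (hℓ : v ⬝ᵥ (evenBlock w win *ᵥ v) ≤ ℓ * (v ⬝ᵥ v))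
    (hσ : autocorr (2 * win.a) v (Real.log p) ≤ -σ * (v ⬝ᵥ v)) (ht : ℓ < 2 * (1 - K) * w p * σ) :
    bottomRayleigh (evenBlock (dial p K w) win) < 0 ∧ datumOf (dial p K w) ∉ oneSignedAt win :=
  have hneg := dial_bottomRayleigh_neg_of_threshold hp hK hw hv hℓ hσ ht
  ⟨hneg, dial_not_mem_oneSignedAt_of_levelDrop hK hw (hneg.trans_le href)⟩

/-! ## §3 The `φ`-floored reader: floored autocorrelation bound and floored nodal forcing -/

/-- PROVED (pointwise, floor from below): `−m ≤ a, b`, `|a|, |b| ≤ M`, `0 ≤ m` ⇒ `a·b ≥ −2mM`. [folklore] -/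
theorem neg_le_mul_of_floor {a b m M : ℝ} (hm : 0 ≤ m) (ha : -m ≤ a) (hb : -m ≤ b) (haM : |a| ≤ M)
    (hbM : |b| ≤ M) : -(2 * m * M) ≤ a * b := by
  have hM : 0 ≤ M := (abs_nonneg a).trans haM
  have ha' : a ≤ M := (le_abs_self a).trans haM
  have hb' : b ≤ M := (le_abs_self b).trans hbM
  have hmM := mul_nonneg hm hM
  rcases le_or_gt 0 a with h0a | h0a <;> rcases le_or_gt 0 b with h0b | h0b
  · nlinarith [mul_nonneg h0a h0b]
  · nlinarith [mul_nonneg h0a (by linarith : 0 ≤ b + m), mul_le_mul_of_nonneg_left ha' hm]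
  · nlinarith [mul_nonneg h0b (by linarith : 0 ≤ a + m), mul_le_mul_of_nonneg_left hb' hm]
  · nlinarith [mul_pos_of_neg_of_neg h0a h0b]

/-- PROVED (pointwise, ceiling from above): `a, b ≤ m`, `|a|, |b| ≤ M`, `0 ≤ m` ⇒ `a·b ≥ −2mM`. [folklore] -/
theorem neg_le_mul_of_ceil {a b m M : ℝ} (hm : 0 ≤ m) (ha : a ≤ m) (hb : b ≤ m) (haM : |a| ≤ M)
    (hbM : |b| ≤ M) : -(2 * m * M) ≤ a * b := by
  have h := neg_le_mul_of_floor hm (neg_le_neg ha) (neg_le_neg hb) ((abs_neg a).symm ▸ haM) ((abs_neg b).symm ▸ hbM)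
  rwa [neg_mul_neg] at h

/-- **PROVED — THE FLOORED AUTOCORRELATION BOUND:** a `φ`-floor one-signed profile (`0 ≤ φ`, `0 < L`) has
`autocorr_u(y) ≥ −2φ(2N+1)·‖u‖²` at every lag `0 ≤ y ≤ L` (pointwise `θ_u(x)θ_u(x+y) ≥ −2φ·(max|θ_u|)²` over a range of
length `≤ L`, and `(max|θ_u|)²·L ≤ (2N+1)‖u‖²`; at `φ = 0` it is the tree's `autocorr_nonneg_of_oneSigned`). [folklore] -/
theorem autocorr_ge_of_floorOneSigned {L φ : ℝ} (hL : 0 < L) (hφ : 0 ≤ φ) {N : ℕ} {u : Fin (N + 1) → ℝ}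
    (h : FloorOneSigned L φ u) {y : ℝ} (hy0 : 0 ≤ y) (hyL : y ≤ L) :
    -(2 * φ * (2 * N + 1) * (u ⬝ᵥ u)) ≤ autocorr L u y := by
  set M := profileMax L u with hMdef
  have hM0 : 0 ≤ M := profileMax_nonneg L u
  have hm : 0 ≤ φ * M := mul_nonneg hφ hM0
  have hpt : ∀ x ∈ Set.Icc (-(L / 2)) (L / 2 - y),
      -(2 * (φ * M) * M) ≤ profile L u x * profile L u (x + y) := by
    intro x hx
    have hx1 : x ∈ Set.Icc (-(L / 2)) (L / 2) := ⟨hx.1, by linarith [hx.2]⟩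
    have hx2 : x + y ∈ Set.Icc (-(L / 2)) (L / 2) := ⟨by linarith [hx.1], by linarith [hx.2]⟩
    have h1 := abs_profile_le_profileMax L u hx1
    have h2 := abs_profile_le_profileMax L u hx2
    rcases h with h | h
    · exact neg_le_mul_of_floor hm (h x hx1) (h _ hx2) h1 h2
    · exact neg_le_mul_of_ceil hm (h x hx1) (h _ hx2) h1 h2
  have hint : IntervalIntegrable (fun x => profile L u x * profile L u (x + y)) MeasureTheory.volume
      (-(L / 2)) (L / 2 - y) :=
    Continuous.intervalIntegrable (by fun_prop) _ _
  have hab : -(L / 2) ≤ L / 2 - y := by linarith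
  have hI : (∫ _ in (-(L / 2))..(L / 2 - y), (-(2 * (φ * M) * M) : ℝ)) ≤ autocorr L u y := by
    unfold autocorr
    exact intervalIntegral.integral_mono_on hab intervalIntegrable_const hint hpt
  rw [intervalIntegral.integral_const, smul_eq_mul] at hI
  have hMsq : M ^ 2 ≤ (u ⬝ᵥ u) * ((2 * N + 1) / L) := profileMax_sq_le hL u
  have hMsq' : M ^ 2 * L ≤ (u ⬝ᵥ u) * (2 * N + 1) := by
    rw [← mul_div_assoc] at hMsq
    exact (le_div_iff₀ hL).1 hMsq
  have h2φ : 0 ≤ 2 * φ := mul_nonneg zero_le_two hφ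
  have k1 : 0 ≤ y * (2 * φ * M ^ 2) := mul_nonneg hy0 (mul_nonneg h2φ (sq_nonneg M))
  have k3 : 2 * φ * (M ^ 2 * L) ≤ 2 * φ * ((u ⬝ᵥ u) * (2 * N + 1)) := mul_le_mul_of_nonneg_left hMsq' h2φ
  linarith [k1, k3, hI]

/-- **PROVED — BELOW THE REFERENCE BY MORE THAN THE FLOOR SLACK IS FLOOR-NODAL (down cone, served reader):** if
`w' ≤ w` on the window's primes, `0 ≤ φ`, and
`ε₁(Q_{w'}; win) < ε₁(Q_w; win) − 4φ(2N+1)·Σ_{q ∈ primeRange 2a} (w q − w' q)`, then NO bottom vector of `Q_{w'}` is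
`φ`-floor one-signed. [folklore] -/
theorem not_floorOneSigned_of_downCone_levelDrop {win : Window} {w w' : Weights} {φ : ℝ} (hφ : 0 ≤ φ)
    (hle : ∀ q ∈ primeRange (2 * win.a), w' q ≤ w q)
    (hdrop : bottomRayleigh (evenBlock w' win) < bottomRayleigh (evenBlock w win)
      - 4 * φ * (2 * win.N + 1) * ∑ q ∈ primeRange (2 * win.a), (w q - w' q))
    {u : Fin (win.N + 1) → ℝ} (hu : IsBottomVector (evenBlock w' win) u) : ¬ FloorOneSigned (2 * win.a) φ u := by
  intro hfl
  have ha2 : 0 < 2 * win.a := by linarith [win.ha]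
  have huu : 0 < u ⬝ᵥ u :=
    lt_of_le_of_ne (dotProduct_self_nonneg_real u) fun h => hu.1 (dotProduct_self_eq_zero.1 h.symm)
  have h1 := form_sub_le_of_isBottomVector (evenBlock w win) (evenBlock w' win) hu
  have h2 : u ⬝ᵥ (evenBlock w' win *ᵥ u) - u ⬝ᵥ (evenBlock w win *ᵥ u)
      = 2 * ∑ q ∈ primeRange (2 * win.a), (w q - w' q) * autocorr (2 * win.a) u (Real.log q) := by
    rw [form_eq_form_add_sum_autocorr w w' u]
    ring
  have h3 : ∀ q ∈ primeRange (2 * win.a),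
      (w q - w' q) * (-(2 * φ * (2 * win.N + 1) * (u ⬝ᵥ u)))
        ≤ (w q - w' q) * autocorr (2 * win.a) u (Real.log q) :=
    fun q hq => mul_le_mul_of_nonneg_left
      (autocorr_ge_of_floorOneSigned ha2 hφ hfl (Real.log_natCast_nonneg q) (log_le_of_mem_primeRange ha2.le hq))
      (sub_nonneg.2 (hle q hq))
  have h4 := Finset.sum_le_sum h3
  rw [← Finset.sum_mul] at h4
  have h5 := mul_lt_mul_of_pos_right hdrop huu
  linarith [h1, h2, h4, h5]

/-- **PROVED (datum level, served reader):** under the same premisses `datumOf w' ∉ floorNodelessAt φ win`. [folklore] -/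
theorem not_mem_floorNodelessAt_of_downCone_levelDrop {win : Window} {w w' : Weights} {φ : ℝ} (hφ : 0 ≤ φ)
    (hle : ∀ q ∈ primeRange (2 * win.a), w' q ≤ w q)
    (hdrop : bottomRayleigh (evenBlock w' win) < bottomRayleigh (evenBlock w win)
      - 4 * φ * (2 * win.N + 1) * ∑ q ∈ primeRange (2 * win.a), (w q - w' q)) :
    datumOf w' ∉ floorNodelessAt φ win := by
  rintro ⟨u, hu, hfl⟩
  exact not_floorOneSigned_of_downCone_levelDrop hφ hle hdrop hu hfl

/-- **PROVED — FLOORED ENERGY DOMINATION:** `datumOf w' ∈ floorNodelessAt φ win` ⇒ `ε₁(Q_w) − 4φ(2N+1)Σ(w − w') ≤ ε₁(Q_{w'})`. [folklore] -/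
theorem bottomRayleigh_le_of_downCone_mem_floorNodelessAt {win : Window} {w w' : Weights} {φ : ℝ} (hφ : 0 ≤ φ)
    (hle : ∀ q ∈ primeRange (2 * win.a), w' q ≤ w q) (hmem : datumOf w' ∈ floorNodelessAt φ win) :
    bottomRayleigh (evenBlock w win) - 4 * φ * (2 * win.N + 1) * ∑ q ∈ primeRange (2 * win.a), (w q - w' q)
      ≤ bottomRayleigh (evenBlock w' win) :=
  not_lt.1 fun hdrop => not_mem_floorNodelessAt_of_downCone_levelDrop hφ hle hdrop hmem

/-- PROVED: the `ℓ¹`-size of one dial as a down move, `Σ_{q ∈ primeRange} (w q − dial p K w q) = (1 − K)·w(p)`. [folklore] -/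
theorem sum_sub_dial_eq {p : ℕ} {L : ℝ} (hp : p ∈ primeRange L) (K : ℝ) (w : Weights) :
    ∑ q ∈ primeRange L, (w q - dial p K w q) = (1 - K) * w p := by
  rw [Finset.sum_eq_single p]
  · show w p - (if p = p then K * w p else w p) = (1 - K) * w p
    rw [if_pos rfl]
    ring
  · intro q _ hq
    simp [dial, hq]
  · intro h
    exact absurd hp h

/-- **PROVED — A DOWN DIAL BELOW THE REFERENCE BY MORE THAN THE FLOOR SLACK IS FLOOR-NODAL:** `p ∈ primeRange 2a`,
`K ≤ 1`, `0 ≤ w p`, `0 ≤ φ`, `ε₁(evenBlock (dial p K w) win) < ε₁(evenBlock w win) − 4φ(2N+1)(1−K)·w(p)` ⇒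
`datumOf (dial p K w) ∉ floorNodelessAt φ win` (the SERVED nodeless-even reader, floor `φ = 10⁻²⁰`). [folklore] -/
theorem dial_not_mem_floorNodelessAt_of_levelDrop {win : Window} {p : ℕ} (hp : p ∈ primeRange (2 * win.a)) {K : ℝ}
    (hK : K ≤ 1) {w : Weights} (hw : 0 ≤ w p) {φ : ℝ} (hφ : 0 ≤ φ)
    (hdrop : bottomRayleigh (evenBlock (dial p K w) win)
      < bottomRayleigh (evenBlock w win) - 4 * φ * (2 * win.N + 1) * ((1 - K) * w p)) :
    datumOf (dial p K w) ∉ floorNodelessAt φ win := by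
  refine not_mem_floorNodelessAt_of_downCone_levelDrop hφ (fun q _ => dial_le_self_of_le_one hK hw q) ?_
  rwa [sum_sub_dial_eq hp]

/-- **PROVED — THE FLOORED AUTOCORRELATION SPLITTING THRESHOLD:** at a window reaching `p`, a test vector `v ≠ 0` of the
reference with `vᵀQ_w v ≤ ℓ‖v‖²` and `autocorr_v(log p) ≤ −σ‖v‖²` makes every down dial `K ≤ 1` (`0 ≤ w p`) with
`2(1−K)·w(p)·(σ − 2φ(2N+1)) > ℓ − ε₁(Q_w)` FLOOR-NODAL at `win` (served floor `φ = 10⁻²⁰`, `N ≤ 10³`: the correction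
`2φ(2N+1) ≤ 4.002·10⁻¹⁷` is invisible next to any measured `σ`). [folklore] -/
theorem dial_not_mem_floorNodelessAt_of_threshold {win : Window} {p : ℕ} (hp : p ∈ primeRange (2 * win.a)) {K : ℝ}
    (hK : K ≤ 1) {w : Weights} (hw : 0 ≤ w p) {φ : ℝ} (hφ : 0 ≤ φ) {v : Fin (win.N + 1) → ℝ} (hv : v ≠ 0)
    {ℓ σ : ℝ} (hℓ : v ⬝ᵥ (evenBlock w win *ᵥ v) ≤ ℓ * (v ⬝ᵥ v))
    (hσ : autocorr (2 * win.a) v (Real.log p) ≤ -σ * (v ⬝ᵥ v))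
    (ht : ℓ - bottomRayleigh (evenBlock w win) < 2 * (1 - K) * w p * (σ - 2 * φ * (2 * win.N + 1))) :
    datumOf (dial p K w) ∉ floorNodelessAt φ win := by
  have hvv : 0 < v ⬝ᵥ v :=
    lt_of_le_of_ne (dotProduct_self_nonneg_real v) fun h => hv (dotProduct_self_eq_zero.1 h.symm)
  apply dial_not_mem_floorNodelessAt_of_levelDrop hp hK hw hφ
  have h := bottomRayleigh_mul_le_form (evenBlock (dial p K w) win) v
  rw [form_evenBlock_dial hp K w v, primePattern_form_eq_autocorr win.ha] at h
  have hc : 0 ≤ 2 * (1 - K) * w p := mul_nonneg (mul_nonneg zero_le_two (sub_nonneg.2 hK)) hw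
  have h1 := mul_le_mul_of_nonneg_left hσ hc
  have h2 := mul_lt_mul_of_pos_right ht hvv
  refine lt_of_mul_lt_mul_right ?_ hvv.le
  linarith

/-- PROVED (`ζ` handle, served reader): the same for down dials of `ζ` (`w = zetaWeights`, `0 ≤ w_ζ(p)` is free). [folklore] -/
theorem zeta_dial_not_mem_floorNodelessAt_of_levelDrop {win : Window} {p : ℕ} (hp : p ∈ primeRange (2 * win.a))
    {K : ℝ} (hK : K ≤ 1) {φ : ℝ} (hφ : 0 ≤ φ)
    (hdrop : bottomRayleigh (evenBlock (dial p K zetaWeights) win)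
      < bottomRayleigh (evenBlock zetaWeights win) - 4 * φ * (2 * win.N + 1) * ((1 - K) * zetaWeights p)) :
    datumOf (dial p K zetaWeights) ∉ floorNodelessAt φ win :=
  dial_not_mem_floorNodelessAt_of_levelDrop hp hK (zetaWeights_nonneg p) hφ hdrop

end Summit.RiemannHypothesis.RiemannHypothesis.Theorems.PfPersistence

end
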